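import Summits.ResolutionOfSingularities.ResolutionOfSingularities.Theorems.FrobeniusLadderFInjectiveMacaulayficationTauFloorF5YChartFacts
import Summits.ResolutionOfSingularities.ResolutionOfSingularities.Theorems.FrobeniusLadderFInjectiveMacaulayficationTauFloorOneChartSymmetry
import HarnessLib

/-!
# (N1-S) The charts `D(ū²)`, `D(t̄²)` of `Bl_τ(P2d4F5)` by the symmetry `y ↔ u ↔ t`: CM at every prime
# (crux `FInjectiveMacaulayfication` stmt-ResolutionOfSingularities-15315, chain w45a; res-L1-w45a-plan-1 R18.32 «(N1) ROW #2 TWO-SIDED → stub-3»;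
# seat res-L1-w45a-stub-3 g10; pattern = res-L1-w45a-stub-1's `TauFloorOneChartSymmetry` p622567, whose generic §1 is reused)

[OURS · L1 W4.5a] Support file (`--supports stmt-ResolutionOfSingularities-15315 --as helper`); def-free, unconditional; replaces the role of NO printed item;
NOT a statement of the manuscript; AI-written (AI review is weaker than expert review).

`f = X₄² + X₀²X₄ + X₁⁵ + X₂⁵ + X₃⁵` is invariant under the transpositions `X₁ ↔ X₂`, `X₁ ↔ X₃`; the induced automorphisms `σ̄` of `A₀ = k[X]/(f)` fix
`τ = (x̄, ȳ², ū², t̄², z̄)` (as a set of generators) and send `ȳ²` to `ū²` resp. `t̄²`, hence induce `A₀[τ/ȳ²] ≃+* A₀[τ/ū²]`, `A₀[τ/ȳ²] ≃+* A₀[τ/t̄²]`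
(`TauFloorOneChartSymmetry.exists_blowupAlgebra_congr'`). Transporting `TauFloorF5YChartFacts.cmCl_localization_blowupAlgebra`:
★ `cmCl_localization_blowupAlgebra_of_swap` — CM at every prime of `A₀[τ/x̄_j²]`, `j ∈ {2, 3}`. (Only the CM half is transported: row #2 needs ONE non-FULL point,
which the chart `D(ȳ²)` already supplies.) [folklore; cite: GortzWedhorn2020, (13.19)]
-/

-- single-problem summit: the doubled namespace component is forced
set_option linter.dupNamespace false

noncomputable section

namespace Summit.ResolutionOfSingularities.ResolutionOfSingularities.Theorems.FInjectiveMacaulayfication.TauFloorF5ChartSymmetry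

open MvPolynomial IsLocalRing Literature.AlgebraicGeometry.Resolution
open Summit.ResolutionOfSingularities.ResolutionOfSingularities.Theorems.FInjectiveMacaulayfication
open SliceableCentre

variable (k : Type) [Field k]

/-! ## §1 The automorphisms `X₁ ↔ X_j` (`j = 2, 3`) of `A₀` -/

/-- For `j ∈ {2, 3}`: the transposition `X₁ ↔ X_j` fixes `f`, so induces `σ̄ : A₀ ≃+* A₀` with `σ̄ x̄ᵢ = x̄_{swap i}`; `σ̄` fixes `τ = (x̄, ȳ², ū², t̄², z̄)` and sends
`ȳ²` to `x̄_j²`. [plumbing] -/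
theorem exists_swap_auto (f : MvPolynomial (Fin 5) k) (hf : f = X 4 ^ 2 + X 0 ^ 2 * X 4 + X 1 ^ 5 + X 2 ^ 5 + X 3 ^ 5) (j : Fin 5) (hj : j = 2 ∨ j = 3) :
    ∃ σ : (MvPolynomial (Fin 5) k ⧸ Ideal.span {f}) ≃+* (MvPolynomial (Fin 5) k ⧸ Ideal.span {f}),
      (∀ i : Fin 5, σ (Ideal.Quotient.mk (Ideal.span {f}) (X i)) = Ideal.Quotient.mk (Ideal.span {f}) (X (Equiv.swap 1 j i))) ∧
      Ideal.map σ (Ideal.span {Ideal.Quotient.mk (Ideal.span {f}) (X 0), Ideal.Quotient.mk (Ideal.span {f}) (X 1) ^ 2,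
          Ideal.Quotient.mk (Ideal.span {f}) (X 2) ^ 2, Ideal.Quotient.mk (Ideal.span {f}) (X 3) ^ 2, Ideal.Quotient.mk (Ideal.span {f}) (X 4)}) =
        Ideal.span {Ideal.Quotient.mk (Ideal.span {f}) (X 0), Ideal.Quotient.mk (Ideal.span {f}) (X 1) ^ 2,
          Ideal.Quotient.mk (Ideal.span {f}) (X 2) ^ 2, Ideal.Quotient.mk (Ideal.span {f}) (X 3) ^ 2, Ideal.Quotient.mk (Ideal.span {f}) (X 4)} ∧
      σ (Ideal.Quotient.mk (Ideal.span {f}) (X 1) ^ 2) = Ideal.Quotient.mk (Ideal.span {f}) (X j) ^ 2 := by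
  set ρ : MvPolynomial (Fin 5) k ≃+* MvPolynomial (Fin 5) k := (renameEquiv k (Equiv.swap (1 : Fin 5) j)).toRingEquiv with hρ
  have hρX : ∀ i : Fin 5, ρ (X i) = X (Equiv.swap 1 j i) := fun i => rename_X _ i
  have hρf : ρ f = f := by
    rw [hf]
    simp only [map_add, map_mul, map_pow, hρX]
    rcases hj with rfl | rfl
    · rw [show Equiv.swap (1 : Fin 5) 2 4 = 4 by decide, show Equiv.swap (1 : Fin 5) 2 0 = 0 by decide, Equiv.swap_apply_left,
        Equiv.swap_apply_right, show Equiv.swap (1 : Fin 5) 2 3 = 3 by decide]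
      ring
    · rw [show Equiv.swap (1 : Fin 5) 3 4 = 4 by decide, show Equiv.swap (1 : Fin 5) 3 0 = 0 by decide, Equiv.swap_apply_left,
        Equiv.swap_apply_right, show Equiv.swap (1 : Fin 5) 3 2 = 2 by decide]
      ring
  have hIJ : Ideal.span {f} = Ideal.map (ρ : MvPolynomial (Fin 5) k →+* MvPolynomial (Fin 5) k) (Ideal.span {f}) := by
    rw [Ideal.map_span, Set.image_singleton]
    exact congrArg _ (congrArg _ hρf.symm)
  have himg : ∀ i : Fin 5, Ideal.quotientEquiv (Ideal.span {f}) (Ideal.span {f}) ρ hIJ (Ideal.Quotient.mk (Ideal.span {f}) (X i)) =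
      Ideal.Quotient.mk (Ideal.span {f}) (X (Equiv.swap 1 j i)) := fun i => by rw [Ideal.quotientEquiv_mk, hρX]
  refine ⟨Ideal.quotientEquiv (Ideal.span {f}) (Ideal.span {f}) ρ hIJ, himg, ?_, ?_⟩
  · rw [Ideal.map_span]
    simp only [Set.image_insert_eq, Set.image_singleton, map_pow, himg]
    rcases hj with rfl | rfl
    · rw [show Equiv.swap (1 : Fin 5) 2 4 = 4 by decide, show Equiv.swap (1 : Fin 5) 2 0 = 0 by decide, Equiv.swap_apply_left,
        Equiv.swap_apply_right, show Equiv.swap (1 : Fin 5) 2 3 = 3 by decide]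
      exact congrArg Ideal.span (by ext; simp only [Set.mem_insert_iff, Set.mem_singleton_iff]; tauto)
    · rw [show Equiv.swap (1 : Fin 5) 3 4 = 4 by decide, show Equiv.swap (1 : Fin 5) 3 0 = 0 by decide, Equiv.swap_apply_left,
        Equiv.swap_apply_right, show Equiv.swap (1 : Fin 5) 3 2 = 2 by decide]
      exact congrArg Ideal.span (by ext; simp only [Set.mem_insert_iff, Set.mem_singleton_iff]; tauto)
  · rw [map_pow, himg, Equiv.swap_apply_left]

/-! ## §2 The charts `D(ū²)` and `D(t̄²)` -/

/-- ★ **Charts `D(x̄_j²)`, `j ∈ {2,3}` (= `D(ū²)`, `D(t̄²)`): CM at every prime of `A₀[τ/x̄_j²]`** (transport of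
`TauFloorF5YChartFacts.cmCl_localization_blowupAlgebra` along the symmetry `X₁ ↔ X_j`). [folklore] -/
theorem cmCl_localization_blowupAlgebra_of_swap (f : MvPolynomial (Fin 5) k) (hf : f = X 4 ^ 2 + X 0 ^ 2 * X 4 + X 1 ^ 5 + X 2 ^ 5 + X 3 ^ 5)
    (j : Fin 5) (hj : j = 2 ∨ j = 3)
    (Q : Ideal (blowupAlgebra (Ideal.span {Ideal.Quotient.mk (Ideal.span {f}) (X 0), Ideal.Quotient.mk (Ideal.span {f}) (X 1) ^ 2,
      Ideal.Quotient.mk (Ideal.span {f}) (X 2) ^ 2, Ideal.Quotient.mk (Ideal.span {f}) (X 3) ^ 2, Ideal.Quotient.mk (Ideal.span {f}) (X 4)} :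
        Ideal (MvPolynomial (Fin 5) k ⧸ Ideal.span {f})) (Ideal.Quotient.mk (Ideal.span {f}) (X j) ^ 2))) [Q.IsPrime] :
    CMCl (Localization.AtPrime Q) := by
  obtain ⟨σ, -, hτ, hy⟩ := exists_swap_auto k f hf j hj
  obtain ⟨E₀, -⟩ := TauFloorOneChartSymmetry.exists_blowupAlgebra_congr' σ _ _ hτ _ _ hy
  exact ReesChartFacts.transport_cmCl E₀ (fun P _ => TauFloorF5YChartFacts.cmCl_localization_blowupAlgebra k f hf P) Q

end Summit.ResolutionOfSingularities.ResolutionOfSingularities.Theorems.FInjectiveMacaulayfication.TauFloorF5ChartSymmetry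

end
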